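import Summits.QuantumFields.YangMills.Theorems.AllWindowsColdBoxBoxHighLineActionSandwichWilson

/-!
# T-S5.7a `WilsonPlaquetteTaylor`, core: the Wilson plaquette cost of four chart points to fourth order, with the cubic (odd) term a
# triple product (STUB-PLAN-S5-STEP2 §3/§8, task file ✓`…Theorems.AllWindowsColdBoxBoxHighLineStep2Wick`; LINE-19 S5 ⟨stmt-QuantumFields-24004⟩/⟨24335⟩)

Width seat `ym-line-sfw-p2-w2` (g31, cell `ym-idea-1`), routed by planner ym-idea-2 g18 («7a → w2 successor after 6a», 2026-08-29T19:32:11Z).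

This file: the generic estimates for four chart points `v : Fin 4 → E3` with `‖v_i‖ ≤ t ≤ 1` — `abs_even_remainder_le`
(`|cost(v) − ‖v₀+v₁−v₂−v₃‖² − (cost(v) − cost(−v))/2| ≤ 42t⁴`) and `abs_odd_remainder_le` (`|(cost(v) − cost(−v))/2 − (−2D(v₁,v₂,v₃) − 2D(v₀,v₂,v₃)
+ 2D(v₀,v₁,v₃) + 2D(v₀,v₁,v₂))| ≤ 8t⁵`); the by-name theorem `wilsonPlaquetteTaylor` (`C = 42`) is the next file.

Proof.  EXACTLY, by ✓brick 1/2 of T-S5.6a (`PlaqCost.re_trace_quad`, Euler's formula `↑(expPauli v) = cos‖v‖·1 + X(sinc‖v‖·v)`):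
`c_p(±a) = 2 − 2(E ± O)` with `E` the even trace polynomial (products of `c_i = cos‖v_i‖` and dot products of `p_i = sinc‖v_i‖·v_i`) and
`O = c₁D(p₂,p₃,p₄) + c₂D(p₁,p₃,p₄) − c₃D(p₁,p₂,p₄) − c₄D(p₁,p₂,p₃)` the triple products (`re_trace_eq`, `re_trace_neg_eq`; the chart is odd:
`plaqVar (−a) = −plaqVar a`, `freeVec_neg`).  Hence `c_p^{odd} = −2·O` and `c_p − c_p^{odd} − s·s = E1 + E2 + E4` — the diagonal, cross and quartic
groups of ✓`PlaqCost.cost_sub_sq_decomp` (`even_decomp`), bounded by ✓`abs_diag_le` / ✓`abs_pair_le` / ✓`abs_quartic_le` by `9t²Σ‖v_i‖² ≤ 36t⁴`;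
the pass `s·s → ‖v₀+v₁−v₂−v₃‖²` costs `6t⁴` (✓`WilsonSandwich.norm_sincSum_sub_plaqLin_le`).  For clause 2, `D(p_a,p_b,p_c) = s_as_bs_c·D(v_a,v_b,v_c)`,
`|c s s s − 1| ≤ t²` (`abs_prod_four_sub_one_le`) and `|D(v,v,v)| ≤ t³` (✓`PlaqCost.abs_triple_le_of`) give `8t⁵`.

Everything proved, Mathlib + tree only, standard axioms; no definitions.
HONEST LABEL: an M-sized brick of STEP 2 of the XL stub S5 (`stub_landauSecondOrder`) of a critic-PASSed DRAFT line; S5, U5, ⟨24004⟩ ⟨24335⟩ ⟨24336⟩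
remain OPEN; no stub is closed by name, no crux, rung or summit is proved; **the Yang–Mills mass gap is NOT proved by this file.**
-/

set_option autoImplicit false

noncomputable section

open Matrix Finset
open Literature.Probability.LatticeModels (Site)
open Literature.MathematicalPhysics.QuantumFieldTheory.Balaban1983to89.B10Eq18SigmaSU2 (su2Coord)
open Literature.MathematicalPhysics.QuantumFieldTheory.Balaban1983to89.B10Eq18SigmaSU2Haar (expPauli)
open Literature.MathematicalPhysics.QuantumLattice (ZdEdge)

namespace Summit.QuantumFields.YangMills.Theorems.AllWindowsColdBoxBoxHighLine

namespace WilsonTaylor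

/-! ## The chart is odd -/

/-- `freeVec` is odd. -/
theorem freeVec_neg (H : ℕ) (a : LandauFree H → E3) (e : ZdEdge 4) : freeVec H (-a) e = -freeVec H a e := by
  unfold freeVec
  split_ifs <;> simp

/-- The plaquette variables are odd. -/
theorem plaqVar_neg (H : ℕ) (x : Site 4) (μ ν : Fin 4) (a : LandauFree H → E3) (i : Fin 4) :
    plaqVar H x μ ν (-a) i = -plaqVar H x μ ν a i := by
  simp only [plaqVar, freeVec_neg]

/-! ## The exact trace polynomial of four chart points and of their negatives -/

/-- `Re tr(U₀U₁U₂⁻¹U₃⁻¹) = 2(E + O)`, `U_i = expPauli v_i`, with `c_i = cos‖v_i‖`, `p_i = sinc‖v_i‖·v_i` (✓`PlaqCost.re_trace_quad`). -/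
theorem re_trace_eq (v : Fin 4 → E3) :
    (((expPauli (v 0) * expPauli (v 1) * (expPauli (v 2))⁻¹ * (expPauli (v 3))⁻¹ : SU2) : Matrix (Fin 2) (Fin 2) ℂ)).trace.re =
      2 * ((Real.cos ‖v 0‖ * Real.cos ‖v 1‖ * Real.cos ‖v 2‖ * Real.cos ‖v 3‖
          - Real.cos ‖v 0‖ * Real.cos ‖v 1‖ * ((Real.sinc ‖v 2‖ • WithLp.ofLp (v 2)) ⬝ᵥ (Real.sinc ‖v 3‖ • WithLp.ofLp (v 3)))
          - Real.cos ‖v 2‖ * Real.cos ‖v 3‖ * ((Real.sinc ‖v 0‖ • WithLp.ofLp (v 0)) ⬝ᵥ (Real.sinc ‖v 1‖ • WithLp.ofLp (v 1)))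
          + Real.cos ‖v 0‖ * Real.cos ‖v 2‖ * ((Real.sinc ‖v 1‖ • WithLp.ofLp (v 1)) ⬝ᵥ (Real.sinc ‖v 3‖ • WithLp.ofLp (v 3)))
          + Real.cos ‖v 0‖ * Real.cos ‖v 3‖ * ((Real.sinc ‖v 1‖ • WithLp.ofLp (v 1)) ⬝ᵥ (Real.sinc ‖v 2‖ • WithLp.ofLp (v 2)))
          + Real.cos ‖v 1‖ * Real.cos ‖v 2‖ * ((Real.sinc ‖v 0‖ • WithLp.ofLp (v 0)) ⬝ᵥ (Real.sinc ‖v 3‖ • WithLp.ofLp (v 3)))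
          + Real.cos ‖v 1‖ * Real.cos ‖v 3‖ * ((Real.sinc ‖v 0‖ • WithLp.ofLp (v 0)) ⬝ᵥ (Real.sinc ‖v 2‖ • WithLp.ofLp (v 2)))
          + ((Real.sinc ‖v 0‖ • WithLp.ofLp (v 0)) ⬝ᵥ (Real.sinc ‖v 1‖ • WithLp.ofLp (v 1))) *
              ((Real.sinc ‖v 2‖ • WithLp.ofLp (v 2)) ⬝ᵥ (Real.sinc ‖v 3‖ • WithLp.ofLp (v 3)))
          - ((Real.sinc ‖v 0‖ • WithLp.ofLp (v 0)) ⬝ᵥ (Real.sinc ‖v 2‖ • WithLp.ofLp (v 2))) *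
              ((Real.sinc ‖v 1‖ • WithLp.ofLp (v 1)) ⬝ᵥ (Real.sinc ‖v 3‖ • WithLp.ofLp (v 3)))
          + ((Real.sinc ‖v 0‖ • WithLp.ofLp (v 0)) ⬝ᵥ (Real.sinc ‖v 3‖ • WithLp.ofLp (v 3))) *
              ((Real.sinc ‖v 1‖ • WithLp.ofLp (v 1)) ⬝ᵥ (Real.sinc ‖v 2‖ • WithLp.ofLp (v 2))))
        + (Real.cos ‖v 0‖ * ((Real.sinc ‖v 1‖ • WithLp.ofLp (v 1)) ⬝ᵥ
              ((Real.sinc ‖v 2‖ • WithLp.ofLp (v 2)) ⨯₃ (Real.sinc ‖v 3‖ • WithLp.ofLp (v 3))))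
          + Real.cos ‖v 1‖ * ((Real.sinc ‖v 0‖ • WithLp.ofLp (v 0)) ⬝ᵥ
              ((Real.sinc ‖v 2‖ • WithLp.ofLp (v 2)) ⨯₃ (Real.sinc ‖v 3‖ • WithLp.ofLp (v 3))))
          - Real.cos ‖v 2‖ * ((Real.sinc ‖v 0‖ • WithLp.ofLp (v 0)) ⬝ᵥ
              ((Real.sinc ‖v 1‖ • WithLp.ofLp (v 1)) ⨯₃ (Real.sinc ‖v 3‖ • WithLp.ofLp (v 3))))
          - Real.cos ‖v 3‖ * ((Real.sinc ‖v 0‖ • WithLp.ofLp (v 0)) ⬝ᵥ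
              ((Real.sinc ‖v 1‖ • WithLp.ofLp (v 1)) ⨯₃ (Real.sinc ‖v 2‖ • WithLp.ofLp (v 2)))))) := by
  have hmul : ∀ x y : SU2, ((x * y : SU2) : Matrix (Fin 2) (Fin 2) ℂ) = (x : Matrix (Fin 2) (Fin 2) ℂ) * (y : Matrix (Fin 2) (Fin 2) ℂ) :=
    fun _ _ => rfl
  rw [hmul, hmul, hmul, PlaqCost.coe_expPauli_eq_cos_add, PlaqCost.coe_expPauli_eq_cos_add, PlaqCost.coe_expPauli_inv_eq_cos_sub,
    PlaqCost.coe_expPauli_inv_eq_cos_sub, PlaqCost.re_trace_quad]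
  ring

/-- The same for the negated variables: `Re tr = 2(E − O)` (dot products are even, triple products odd). -/
theorem re_trace_neg_eq (v : Fin 4 → E3) :
    (((expPauli (-v 0) * expPauli (-v 1) * (expPauli (-v 2))⁻¹ * (expPauli (-v 3))⁻¹ : SU2) : Matrix (Fin 2) (Fin 2) ℂ)).trace.re =
      2 * ((Real.cos ‖v 0‖ * Real.cos ‖v 1‖ * Real.cos ‖v 2‖ * Real.cos ‖v 3‖
          - Real.cos ‖v 0‖ * Real.cos ‖v 1‖ * ((Real.sinc ‖v 2‖ • WithLp.ofLp (v 2)) ⬝ᵥ (Real.sinc ‖v 3‖ • WithLp.ofLp (v 3)))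
          - Real.cos ‖v 2‖ * Real.cos ‖v 3‖ * ((Real.sinc ‖v 0‖ • WithLp.ofLp (v 0)) ⬝ᵥ (Real.sinc ‖v 1‖ • WithLp.ofLp (v 1)))
          + Real.cos ‖v 0‖ * Real.cos ‖v 2‖ * ((Real.sinc ‖v 1‖ • WithLp.ofLp (v 1)) ⬝ᵥ (Real.sinc ‖v 3‖ • WithLp.ofLp (v 3)))
          + Real.cos ‖v 0‖ * Real.cos ‖v 3‖ * ((Real.sinc ‖v 1‖ • WithLp.ofLp (v 1)) ⬝ᵥ (Real.sinc ‖v 2‖ • WithLp.ofLp (v 2)))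
          + Real.cos ‖v 1‖ * Real.cos ‖v 2‖ * ((Real.sinc ‖v 0‖ • WithLp.ofLp (v 0)) ⬝ᵥ (Real.sinc ‖v 3‖ • WithLp.ofLp (v 3)))
          + Real.cos ‖v 1‖ * Real.cos ‖v 3‖ * ((Real.sinc ‖v 0‖ • WithLp.ofLp (v 0)) ⬝ᵥ (Real.sinc ‖v 2‖ • WithLp.ofLp (v 2)))
          + ((Real.sinc ‖v 0‖ • WithLp.ofLp (v 0)) ⬝ᵥ (Real.sinc ‖v 1‖ • WithLp.ofLp (v 1))) *
              ((Real.sinc ‖v 2‖ • WithLp.ofLp (v 2)) ⬝ᵥ (Real.sinc ‖v 3‖ • WithLp.ofLp (v 3)))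
          - ((Real.sinc ‖v 0‖ • WithLp.ofLp (v 0)) ⬝ᵥ (Real.sinc ‖v 2‖ • WithLp.ofLp (v 2))) *
              ((Real.sinc ‖v 1‖ • WithLp.ofLp (v 1)) ⬝ᵥ (Real.sinc ‖v 3‖ • WithLp.ofLp (v 3)))
          + ((Real.sinc ‖v 0‖ • WithLp.ofLp (v 0)) ⬝ᵥ (Real.sinc ‖v 3‖ • WithLp.ofLp (v 3))) *
              ((Real.sinc ‖v 1‖ • WithLp.ofLp (v 1)) ⬝ᵥ (Real.sinc ‖v 2‖ • WithLp.ofLp (v 2))))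
        - (Real.cos ‖v 0‖ * ((Real.sinc ‖v 1‖ • WithLp.ofLp (v 1)) ⬝ᵥ
              ((Real.sinc ‖v 2‖ • WithLp.ofLp (v 2)) ⨯₃ (Real.sinc ‖v 3‖ • WithLp.ofLp (v 3))))
          + Real.cos ‖v 1‖ * ((Real.sinc ‖v 0‖ • WithLp.ofLp (v 0)) ⬝ᵥ
              ((Real.sinc ‖v 2‖ • WithLp.ofLp (v 2)) ⨯₃ (Real.sinc ‖v 3‖ • WithLp.ofLp (v 3))))
          - Real.cos ‖v 2‖ * ((Real.sinc ‖v 0‖ • WithLp.ofLp (v 0)) ⬝ᵥ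
              ((Real.sinc ‖v 1‖ • WithLp.ofLp (v 1)) ⨯₃ (Real.sinc ‖v 3‖ • WithLp.ofLp (v 3))))
          - Real.cos ‖v 3‖ * ((Real.sinc ‖v 0‖ • WithLp.ofLp (v 0)) ⬝ᵥ
              ((Real.sinc ‖v 1‖ • WithLp.ofLp (v 1)) ⨯₃ (Real.sinc ‖v 2‖ • WithLp.ofLp (v 2)))))) := by
  have h := re_trace_eq (fun i => -v i)
  simp only [norm_neg, WithLp.ofLp_neg, smul_neg, neg_dotProduct, dotProduct_neg, neg_neg, map_neg, LinearMap.neg_apply] at h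
  rw [h]
  ring

/-- The EVEN identity: `2 − 2E − s·s = E1 + E2 + E4` (the diagonal, cross and quartic groups of ✓`PlaqCost.cost_sub_sq_decomp`). -/
theorem even_decomp (c₁ c₂ c₃ c₄ : ℝ) (p₁ p₂ p₃ p₄ : Fin 3 → ℝ) :
    2 - 2 * (c₁ * c₂ * c₃ * c₄ - c₁ * c₂ * (p₃ ⬝ᵥ p₄) - c₃ * c₄ * (p₁ ⬝ᵥ p₂) + c₁ * c₃ * (p₂ ⬝ᵥ p₄) + c₁ * c₄ * (p₂ ⬝ᵥ p₃)
        + c₂ * c₃ * (p₁ ⬝ᵥ p₄) + c₂ * c₄ * (p₁ ⬝ᵥ p₃) + (p₁ ⬝ᵥ p₂) * (p₃ ⬝ᵥ p₄) - (p₁ ⬝ᵥ p₃) * (p₂ ⬝ᵥ p₄) + (p₁ ⬝ᵥ p₄) * (p₂ ⬝ᵥ p₃))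
      - (p₁ + p₂ - p₃ - p₄) ⬝ᵥ (p₁ + p₂ - p₃ - p₄) =
      (2 - 2 * (c₁ * c₂ * c₃ * c₄) - (p₁ ⬝ᵥ p₁ + p₂ ⬝ᵥ p₂ + p₃ ⬝ᵥ p₃ + p₄ ⬝ᵥ p₄))
      + (2 * (c₃ * c₄ - 1) * (p₁ ⬝ᵥ p₂) + 2 * (c₁ * c₂ - 1) * (p₃ ⬝ᵥ p₄) - 2 * (c₁ * c₃ - 1) * (p₂ ⬝ᵥ p₄)
          - 2 * (c₁ * c₄ - 1) * (p₂ ⬝ᵥ p₃) - 2 * (c₂ * c₃ - 1) * (p₁ ⬝ᵥ p₄) - 2 * (c₂ * c₄ - 1) * (p₁ ⬝ᵥ p₃))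
      + (-2 * ((p₁ ⬝ᵥ p₂) * (p₃ ⬝ᵥ p₄)) + 2 * ((p₁ ⬝ᵥ p₃) * (p₂ ⬝ᵥ p₄)) - 2 * ((p₁ ⬝ᵥ p₄) * (p₂ ⬝ᵥ p₃))) := by
  simp only [dotProduct, Fin.sum_univ_three, Pi.add_apply, Pi.sub_apply]
  ring

/-! ## Estimates -/

/-- The even groups: `|E1 + E2 + E4| ≤ 9t²·Σt_i²` (✓`PlaqCost.abs_diag_le`, six ✓`abs_pair_le`, ✓`abs_quartic_le`). -/
theorem abs_even_le (c₁ c₂ c₃ c₄ : ℝ) (p₁ p₂ p₃ p₄ : Fin 3 → ℝ) {t t₁ t₂ t₃ t₄ : ℝ} (ht : t ≤ 1)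
    (h₁ : t₁ ≤ t) (h₂ : t₂ ≤ t) (h₃ : t₃ ≤ t) (h₄ : t₄ ≤ t) (h₁0 : 0 ≤ t₁) (h₂0 : 0 ≤ t₂) (h₃0 : 0 ≤ t₃) (h₄0 : 0 ≤ t₄)
    (hc₁ : 1 - t₁ ^ 2 / 2 ≤ c₁) (hc₂ : 1 - t₂ ^ 2 / 2 ≤ c₂) (hc₃ : 1 - t₃ ^ 2 / 2 ≤ c₃) (hc₄ : 1 - t₄ ^ 2 / 2 ≤ c₄)
    (hc₁1 : c₁ ≤ 1) (hc₂1 : c₂ ≤ 1) (hc₃1 : c₃ ≤ 1) (hc₄1 : c₄ ≤ 1)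
    (hp₁ : p₁ ⬝ᵥ p₁ = 1 - c₁ ^ 2) (hp₂ : p₂ ⬝ᵥ p₂ = 1 - c₂ ^ 2) (hp₃ : p₃ ⬝ᵥ p₃ = 1 - c₃ ^ 2) (hp₄ : p₄ ⬝ᵥ p₄ = 1 - c₄ ^ 2) :
    |(2 - 2 * (c₁ * c₂ * c₃ * c₄) - (p₁ ⬝ᵥ p₁ + p₂ ⬝ᵥ p₂ + p₃ ⬝ᵥ p₃ + p₄ ⬝ᵥ p₄))
      + (2 * (c₃ * c₄ - 1) * (p₁ ⬝ᵥ p₂) + 2 * (c₁ * c₂ - 1) * (p₃ ⬝ᵥ p₄) - 2 * (c₁ * c₃ - 1) * (p₂ ⬝ᵥ p₄)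
          - 2 * (c₁ * c₄ - 1) * (p₂ ⬝ᵥ p₃) - 2 * (c₂ * c₃ - 1) * (p₁ ⬝ᵥ p₄) - 2 * (c₂ * c₄ - 1) * (p₁ ⬝ᵥ p₃))
      + (-2 * ((p₁ ⬝ᵥ p₂) * (p₃ ⬝ᵥ p₄)) + 2 * ((p₁ ⬝ᵥ p₃) * (p₂ ⬝ᵥ p₄)) - 2 * ((p₁ ⬝ᵥ p₄) * (p₂ ⬝ᵥ p₃)))| ≤
      9 * t ^ 2 * (t₁ ^ 2 + t₂ ^ 2 + t₃ ^ 2 + t₄ ^ 2) := by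
  have n₁ := PlaqCost.sqrt_dot_le_of h₁0 hc₁ hc₁1 hp₁
  have n₂ := PlaqCost.sqrt_dot_le_of h₂0 hc₂ hc₂1 hp₂
  have n₃ := PlaqCost.sqrt_dot_le_of h₃0 hc₃ hc₃1 hp₃
  have n₄ := PlaqCost.sqrt_dot_le_of h₄0 hc₄ hc₄1 hp₄
  have ht₁1 : t₁ ^ 2 ≤ t ^ 2 := pow_le_pow_left₀ h₁0 h₁ 2
  have ht₂1 : t₂ ^ 2 ≤ t ^ 2 := pow_le_pow_left₀ h₂0 h₂ 2
  have ht₃1 : t₃ ^ 2 ≤ t ^ 2 := pow_le_pow_left₀ h₃0 h₃ 2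
  have ht₄1 : t₄ ^ 2 ≤ t ^ 2 := pow_le_pow_left₀ h₄0 h₄ 2
  have ht0 : 0 ≤ t := h₁0.trans h₁
  have htt : t ^ 2 ≤ 1 := by nlinarith
  have hE1 := PlaqCost.abs_diag_le htt ht₁1 ht₂1 ht₃1 ht₄1 hc₁ hc₂ hc₃ hc₄ hc₁1 hc₂1 hc₃1 hc₄1
  rw [← hp₁, ← hp₂, ← hp₃, ← hp₄] at hE1
  have a12 := PlaqCost.abs_pair_le p₁ p₂ htt hc₃ hc₃1 hc₄ hc₄1 ht₃1 ht₄1 n₁ n₂ h₁0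
  have a34 := PlaqCost.abs_pair_le p₃ p₄ htt hc₁ hc₁1 hc₂ hc₂1 ht₁1 ht₂1 n₃ n₄ h₃0
  have a24 := PlaqCost.abs_pair_le p₂ p₄ htt hc₁ hc₁1 hc₃ hc₃1 ht₁1 ht₃1 n₂ n₄ h₂0
  have a23 := PlaqCost.abs_pair_le p₂ p₃ htt hc₁ hc₁1 hc₄ hc₄1 ht₁1 ht₄1 n₂ n₃ h₂0
  have a14 := PlaqCost.abs_pair_le p₁ p₄ htt hc₂ hc₂1 hc₃ hc₃1 ht₂1 ht₃1 n₁ n₄ h₁0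
  have a13 := PlaqCost.abs_pair_le p₁ p₃ htt hc₂ hc₂1 hc₄ hc₄1 ht₂1 ht₄1 n₁ n₃ h₁0
  have hE2 : |2 * (c₃ * c₄ - 1) * (p₁ ⬝ᵥ p₂) + 2 * (c₁ * c₂ - 1) * (p₃ ⬝ᵥ p₄) - 2 * (c₁ * c₃ - 1) * (p₂ ⬝ᵥ p₄)
      - 2 * (c₁ * c₄ - 1) * (p₂ ⬝ᵥ p₃) - 2 * (c₂ * c₃ - 1) * (p₁ ⬝ᵥ p₄) - 2 * (c₂ * c₄ - 1) * (p₁ ⬝ᵥ p₃)| ≤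
      3 * t ^ 2 * (t₁ ^ 2 + t₂ ^ 2 + t₃ ^ 2 + t₄ ^ 2) := by
    refine (abs_sub _ _).trans ?_
    refine (add_le_add ((abs_sub _ _).trans (add_le_add ((abs_sub _ _).trans (add_le_add ((abs_sub _ _).trans
      (add_le_add ((abs_add_le _ _).trans (add_le_add a12 a34)) a24)) a23)) a14)) a13).trans ?_
    linarith
  have hE4 := PlaqCost.abs_quartic_le p₁ p₂ p₃ p₄ h₁ h₂ h₁0 h₂0 h₃0 h₄0 n₁ n₂ n₃ n₄
  calc _ ≤ |2 - 2 * (c₁ * c₂ * c₃ * c₄) - (p₁ ⬝ᵥ p₁ + p₂ ⬝ᵥ p₂ + p₃ ⬝ᵥ p₃ + p₄ ⬝ᵥ p₄)|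
        + |2 * (c₃ * c₄ - 1) * (p₁ ⬝ᵥ p₂) + 2 * (c₁ * c₂ - 1) * (p₃ ⬝ᵥ p₄) - 2 * (c₁ * c₃ - 1) * (p₂ ⬝ᵥ p₄)
            - 2 * (c₁ * c₄ - 1) * (p₂ ⬝ᵥ p₃) - 2 * (c₂ * c₃ - 1) * (p₁ ⬝ᵥ p₄) - 2 * (c₂ * c₄ - 1) * (p₁ ⬝ᵥ p₃)|
        + |-2 * ((p₁ ⬝ᵥ p₂) * (p₃ ⬝ᵥ p₄)) + 2 * ((p₁ ⬝ᵥ p₃) * (p₂ ⬝ᵥ p₄)) - 2 * ((p₁ ⬝ᵥ p₄) * (p₂ ⬝ᵥ p₃))| :=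
        (abs_add_le _ _).trans (add_le_add (abs_add_le _ _) le_rfl)
    _ ≤ _ := by linarith [hE1, hE2, hE4]

/-- Products of four numbers in `[1 − e_i, 1]` (`e_i ≤ 1`): `|x₁x₂x₃x₄ − 1| ≤ e₁ + e₂ + e₃ + e₄`. -/
theorem abs_prod_four_sub_one_le {x₁ x₂ x₃ x₄ e₁ e₂ e₃ e₄ : ℝ} (h₁ : 1 - e₁ ≤ x₁) (h₂ : 1 - e₂ ≤ x₂) (h₃ : 1 - e₃ ≤ x₃)
    (h₄ : 1 - e₄ ≤ x₄) (g₁ : x₁ ≤ 1) (g₂ : x₂ ≤ 1) (g₃ : x₃ ≤ 1) (g₄ : x₄ ≤ 1) (f₁ : e₁ ≤ 1) (f₂ : e₂ ≤ 1) (f₃ : e₃ ≤ 1)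
    (f₄ : e₄ ≤ 1) : |x₁ * x₂ * x₃ * x₄ - 1| ≤ e₁ + e₂ + e₃ + e₄ := by
  have p₁ : 0 ≤ x₁ := by linarith
  have p₂ : 0 ≤ x₂ := by linarith
  have p₃ : 0 ≤ x₃ := by linarith
  have p₄ : 0 ≤ x₄ := by linarith
  have u12 : x₁ * x₂ ≤ 1 := mul_le_one₀ g₁ p₂ g₂
  have u123 : x₁ * x₂ * x₃ ≤ 1 := mul_le_one₀ u12 p₃ g₃
  have u1234 : x₁ * x₂ * x₃ * x₄ ≤ 1 := mul_le_one₀ u123 p₄ g₄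
  -- `1 − ab ≤ (1 − a) + (1 − b)` for `a, b ≤ 1`
  have l12 : 1 - x₁ * x₂ ≤ (1 - x₁) + (1 - x₂) := by nlinarith [mul_nonneg (sub_nonneg.2 g₁) (sub_nonneg.2 g₂)]
  have l123 : 1 - x₁ * x₂ * x₃ ≤ (1 - x₁ * x₂) + (1 - x₃) := by nlinarith [mul_nonneg (sub_nonneg.2 u12) (sub_nonneg.2 g₃)]
  have l1234 : 1 - x₁ * x₂ * x₃ * x₄ ≤ (1 - x₁ * x₂ * x₃) + (1 - x₄) := by
    nlinarith [mul_nonneg (sub_nonneg.2 u123) (sub_nonneg.2 g₄)]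
  rw [abs_sub_comm, abs_of_nonneg (by linarith)]
  linarith

/-- The ODD group against the triple-product form: with `p_i = s_i·w_i`, `1 − t_i²/2 ≤ c_i ≤ 1`, `1 − t_i²/6 ≤ s_i ≤ 1`, `|w_i| ≤ t_i ≤ t ≤ 1`:
`|−2·O(c, p) − (−2D(w₂,w₃,w₄) − 2D(w₁,w₃,w₄) + 2D(w₁,w₂,w₄) + 2D(w₁,w₂,w₃))| ≤ 8t⁵`. -/
theorem abs_odd_sub_triple_le (c₁ c₂ c₃ c₄ s₁ s₂ s₃ s₄ : ℝ) (w₁ w₂ w₃ w₄ : Fin 3 → ℝ) {t t₁ t₂ t₃ t₄ : ℝ} (ht : t ≤ 1)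
    (h₁ : t₁ ≤ t) (h₂ : t₂ ≤ t) (h₃ : t₃ ≤ t) (h₄ : t₄ ≤ t) (h₁0 : 0 ≤ t₁) (h₂0 : 0 ≤ t₂) (h₃0 : 0 ≤ t₃) (h₄0 : 0 ≤ t₄)
    (hc₁ : 1 - t₁ ^ 2 / 2 ≤ c₁) (hc₂ : 1 - t₂ ^ 2 / 2 ≤ c₂) (hc₃ : 1 - t₃ ^ 2 / 2 ≤ c₃) (hc₄ : 1 - t₄ ^ 2 / 2 ≤ c₄)
    (hc₁1 : c₁ ≤ 1) (hc₂1 : c₂ ≤ 1) (hc₃1 : c₃ ≤ 1) (hc₄1 : c₄ ≤ 1)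
    (hs₁ : 1 - t₁ ^ 2 / 6 ≤ s₁) (hs₂ : 1 - t₂ ^ 2 / 6 ≤ s₂) (hs₃ : 1 - t₃ ^ 2 / 6 ≤ s₃) (hs₄ : 1 - t₄ ^ 2 / 6 ≤ s₄)
    (hs₁1 : s₁ ≤ 1) (hs₂1 : s₂ ≤ 1) (hs₃1 : s₃ ≤ 1) (hs₄1 : s₄ ≤ 1)
    (n₁ : Real.sqrt (w₁ ⬝ᵥ w₁) ≤ t₁) (n₂ : Real.sqrt (w₂ ⬝ᵥ w₂) ≤ t₂) (n₃ : Real.sqrt (w₃ ⬝ᵥ w₃) ≤ t₃) (n₄ : Real.sqrt (w₄ ⬝ᵥ w₄) ≤ t₄) :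
    |-2 * (c₁ * ((s₂ • w₂) ⬝ᵥ ((s₃ • w₃) ⨯₃ (s₄ • w₄))) + c₂ * ((s₁ • w₁) ⬝ᵥ ((s₃ • w₃) ⨯₃ (s₄ • w₄)))
        - c₃ * ((s₁ • w₁) ⬝ᵥ ((s₂ • w₂) ⨯₃ (s₄ • w₄))) - c₄ * ((s₁ • w₁) ⬝ᵥ ((s₂ • w₂) ⨯₃ (s₃ • w₃))))
      - (-2 * (w₂ ⬝ᵥ (w₃ ⨯₃ w₄)) - 2 * (w₁ ⬝ᵥ (w₃ ⨯₃ w₄)) + 2 * (w₁ ⬝ᵥ (w₂ ⨯₃ w₄)) + 2 * (w₁ ⬝ᵥ (w₂ ⨯₃ w₃)))| ≤ 8 * t ^ 5 := by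
  have ht0 : 0 ≤ t := h₁0.trans h₁
  -- trilinearity
  have tri : ∀ (a b c : ℝ) (x y z : Fin 3 → ℝ), (a • x) ⬝ᵥ ((b • y) ⨯₃ (c • z)) = a * b * c * (x ⬝ᵥ (y ⨯₃ z)) := by
    intro a b c x y z
    simp only [map_smul, LinearMap.smul_apply, smul_dotProduct, dotProduct_smul, smul_eq_mul]
    ring
  rw [tri, tri, tri, tri]
  -- sizes of the triple products
  have d234 : |w₂ ⬝ᵥ (w₃ ⨯₃ w₄)| ≤ t ^ 3 := by
    refine (PlaqCost.abs_triple_le_of w₂ w₃ w₄ n₂ n₃ n₄ h₃0).trans ?_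
    calc t₂ * (t₃ * t₄) ≤ t * (t * t) := mul_le_mul h₂ (mul_le_mul h₃ h₄ h₄0 ht0) (mul_nonneg h₃0 h₄0) ht0
      _ = t ^ 3 := by ring
  have d134 : |w₁ ⬝ᵥ (w₃ ⨯₃ w₄)| ≤ t ^ 3 := by
    refine (PlaqCost.abs_triple_le_of w₁ w₃ w₄ n₁ n₃ n₄ h₃0).trans ?_
    calc t₁ * (t₃ * t₄) ≤ t * (t * t) := mul_le_mul h₁ (mul_le_mul h₃ h₄ h₄0 ht0) (mul_nonneg h₃0 h₄0) ht0
      _ = t ^ 3 := by ring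
  have d124 : |w₁ ⬝ᵥ (w₂ ⨯₃ w₄)| ≤ t ^ 3 := by
    refine (PlaqCost.abs_triple_le_of w₁ w₂ w₄ n₁ n₂ n₄ h₂0).trans ?_
    calc t₁ * (t₂ * t₄) ≤ t * (t * t) := mul_le_mul h₁ (mul_le_mul h₂ h₄ h₄0 ht0) (mul_nonneg h₂0 h₄0) ht0
      _ = t ^ 3 := by ring
  have d123 : |w₁ ⬝ᵥ (w₂ ⨯₃ w₃)| ≤ t ^ 3 := by
    refine (PlaqCost.abs_triple_le_of w₁ w₂ w₃ n₁ n₂ n₃ h₂0).trans ?_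
    calc t₁ * (t₂ * t₃) ≤ t * (t * t) := mul_le_mul h₁ (mul_le_mul h₂ h₃ h₃0 ht0) (mul_nonneg h₂0 h₃0) ht0
      _ = t ^ 3 := by ring
  -- the coefficients `c s s s − 1`
  have ht₁1 : t₁ ^ 2 ≤ t ^ 2 := pow_le_pow_left₀ h₁0 h₁ 2
  have ht₂1 : t₂ ^ 2 ≤ t ^ 2 := pow_le_pow_left₀ h₂0 h₂ 2
  have ht₃1 : t₃ ^ 2 ≤ t ^ 2 := pow_le_pow_left₀ h₃0 h₃ 2
  have ht₄1 : t₄ ^ 2 ≤ t ^ 2 := pow_le_pow_left₀ h₄0 h₄ 2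
  have htt : t ^ 2 ≤ 1 := by nlinarith
  have k1 : |c₁ * s₂ * s₃ * s₄ - 1| ≤ t ^ 2 :=
    (abs_prod_four_sub_one_le (e₁ := t₁ ^ 2 / 2) (e₂ := t₂ ^ 2 / 6) (e₃ := t₃ ^ 2 / 6) (e₄ := t₄ ^ 2 / 6) hc₁ hs₂ hs₃ hs₄ hc₁1 hs₂1
      hs₃1 hs₄1 (by linarith) (by linarith) (by linarith) (by linarith)).trans (by linarith)
  have k2 : |c₂ * s₁ * s₃ * s₄ - 1| ≤ t ^ 2 :=
    (abs_prod_four_sub_one_le (e₁ := t₂ ^ 2 / 2) (e₂ := t₁ ^ 2 / 6) (e₃ := t₃ ^ 2 / 6) (e₄ := t₄ ^ 2 / 6) hc₂ hs₁ hs₃ hs₄ hc₂1 hs₁1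
      hs₃1 hs₄1 (by linarith) (by linarith) (by linarith) (by linarith)).trans (by linarith)
  have k3 : |c₃ * s₁ * s₂ * s₄ - 1| ≤ t ^ 2 :=
    (abs_prod_four_sub_one_le (e₁ := t₃ ^ 2 / 2) (e₂ := t₁ ^ 2 / 6) (e₃ := t₂ ^ 2 / 6) (e₄ := t₄ ^ 2 / 6) hc₃ hs₁ hs₂ hs₄ hc₃1 hs₁1
      hs₂1 hs₄1 (by linarith) (by linarith) (by linarith) (by linarith)).trans (by linarith)
  have k4 : |c₄ * s₁ * s₂ * s₃ - 1| ≤ t ^ 2 :=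
    (abs_prod_four_sub_one_le (e₁ := t₄ ^ 2 / 2) (e₂ := t₁ ^ 2 / 6) (e₃ := t₂ ^ 2 / 6) (e₄ := t₃ ^ 2 / 6) hc₄ hs₁ hs₂ hs₃ hc₄1 hs₁1
      hs₂1 hs₃1 (by linarith) (by linarith) (by linarith) (by linarith)).trans (by linarith)
  have z1 : |(c₁ * s₂ * s₃ * s₄ - 1) * (w₂ ⬝ᵥ (w₃ ⨯₃ w₄))| ≤ t ^ 2 * t ^ 3 := by
    rw [abs_mul]; exact mul_le_mul k1 d234 (abs_nonneg _) (by positivity)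
  have z2 : |(c₂ * s₁ * s₃ * s₄ - 1) * (w₁ ⬝ᵥ (w₃ ⨯₃ w₄))| ≤ t ^ 2 * t ^ 3 := by
    rw [abs_mul]; exact mul_le_mul k2 d134 (abs_nonneg _) (by positivity)
  have z3 : |(c₃ * s₁ * s₂ * s₄ - 1) * (w₁ ⬝ᵥ (w₂ ⨯₃ w₄))| ≤ t ^ 2 * t ^ 3 := by
    rw [abs_mul]; exact mul_le_mul k3 d124 (abs_nonneg _) (by positivity)
  have z4 : |(c₄ * s₁ * s₂ * s₃ - 1) * (w₁ ⬝ᵥ (w₂ ⨯₃ w₃))| ≤ t ^ 2 * t ^ 3 := by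
    rw [abs_mul]; exact mul_le_mul k4 d123 (abs_nonneg _) (by positivity)
  have hrw : -2 * (c₁ * (s₂ * s₃ * s₄ * (w₂ ⬝ᵥ (w₃ ⨯₃ w₄))) + c₂ * (s₁ * s₃ * s₄ * (w₁ ⬝ᵥ (w₃ ⨯₃ w₄)))
        - c₃ * (s₁ * s₂ * s₄ * (w₁ ⬝ᵥ (w₂ ⨯₃ w₄))) - c₄ * (s₁ * s₂ * s₃ * (w₁ ⬝ᵥ (w₂ ⨯₃ w₃))))
      - (-2 * (w₂ ⬝ᵥ (w₃ ⨯₃ w₄)) - 2 * (w₁ ⬝ᵥ (w₃ ⨯₃ w₄)) + 2 * (w₁ ⬝ᵥ (w₂ ⨯₃ w₄)) + 2 * (w₁ ⬝ᵥ (w₂ ⨯₃ w₃))) =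
      -2 * ((c₁ * s₂ * s₃ * s₄ - 1) * (w₂ ⬝ᵥ (w₃ ⨯₃ w₄))) + (-2) * ((c₂ * s₁ * s₃ * s₄ - 1) * (w₁ ⬝ᵥ (w₃ ⨯₃ w₄)))
        + 2 * ((c₃ * s₁ * s₂ * s₄ - 1) * (w₁ ⬝ᵥ (w₂ ⨯₃ w₄))) + 2 * ((c₄ * s₁ * s₂ * s₃ - 1) * (w₁ ⬝ᵥ (w₂ ⨯₃ w₃))) := by ring
  rw [hrw]
  have e : |-2 * ((c₁ * s₂ * s₃ * s₄ - 1) * (w₂ ⬝ᵥ (w₃ ⨯₃ w₄))) + (-2) * ((c₂ * s₁ * s₃ * s₄ - 1) * (w₁ ⬝ᵥ (w₃ ⨯₃ w₄)))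
        + 2 * ((c₃ * s₁ * s₂ * s₄ - 1) * (w₁ ⬝ᵥ (w₂ ⨯₃ w₄))) + 2 * ((c₄ * s₁ * s₂ * s₃ - 1) * (w₁ ⬝ᵥ (w₂ ⨯₃ w₃)))| ≤
      2 * |(c₁ * s₂ * s₃ * s₄ - 1) * (w₂ ⬝ᵥ (w₃ ⨯₃ w₄))| + 2 * |(c₂ * s₁ * s₃ * s₄ - 1) * (w₁ ⬝ᵥ (w₃ ⨯₃ w₄))|
        + 2 * |(c₃ * s₁ * s₂ * s₄ - 1) * (w₁ ⬝ᵥ (w₂ ⨯₃ w₄))| + 2 * |(c₄ * s₁ * s₂ * s₃ - 1) * (w₁ ⬝ᵥ (w₂ ⨯₃ w₃))| := by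
    refine (abs_add_le _ _).trans (add_le_add ((abs_add_le _ _).trans (add_le_add ((abs_add_le _ _).trans (add_le_add ?_ ?_)) ?_)) ?_)
    · rw [abs_mul, abs_neg, abs_two]
    · rw [abs_mul, abs_neg, abs_two]
    · rw [abs_mul, abs_two]
    · rw [abs_mul, abs_two]
  have ht5 : t ^ 2 * t ^ 3 = t ^ 5 := by ring
  rw [ht5] at z1 z2 z3 z4
  linarith

/-! ## The chart cost: clause 1 and clause 2 for four chart points -/

/-- `Σ± sinc‖v_i‖·v_i` in coordinates. -/
theorem ofLp_sincSum (v : Fin 4 → E3) :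
    Real.sinc ‖v 0‖ • WithLp.ofLp (v 0) + Real.sinc ‖v 1‖ • WithLp.ofLp (v 1) - Real.sinc ‖v 2‖ • WithLp.ofLp (v 2) -
      Real.sinc ‖v 3‖ • WithLp.ofLp (v 3) =
      WithLp.ofLp (Real.sinc ‖v 0‖ • v 0 + Real.sinc ‖v 1‖ • v 1 - Real.sinc ‖v 2‖ • v 2 - Real.sinc ‖v 3‖ • v 3) := by
  simp only [WithLp.ofLp_add, WithLp.ofLp_sub, WithLp.ofLp_smul]

/-- `|‖S‖² − ‖b‖²| ≤ 6t⁴` for the `sinc`-sum `S` and the circulation `b = plaqLin v`, `‖v_i‖ ≤ t ≤ 1`. -/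
theorem abs_norm_sincSum_sq_sub_le (v : Fin 4 → E3) {t : ℝ} (ht0 : 0 ≤ t) (ht1 : t ≤ 1) (hv : ∀ i, ‖v i‖ ≤ t) :
    |‖Real.sinc ‖v 0‖ • v 0 + Real.sinc ‖v 1‖ • v 1 - Real.sinc ‖v 2‖ • v 2 - Real.sinc ‖v 3‖ • v 3‖ ^ 2 - ‖plaqLin v‖ ^ 2| ≤
      6 * t ^ 4 := by
  have hd : ‖(Real.sinc ‖v 0‖ • v 0 + Real.sinc ‖v 1‖ • v 1 - Real.sinc ‖v 2‖ • v 2 - Real.sinc ‖v 3‖ • v 3) - plaqLin v‖ ≤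
      2 / 3 * t ^ 3 := by
    refine (WilsonSandwich.norm_sincSum_sub_plaqLin_le v hv).trans ?_
    have : ‖v 0‖ + ‖v 1‖ + ‖v 2‖ + ‖v 3‖ ≤ 4 * t := by linarith [hv 0, hv 1, hv 2, hv 3]
    calc t ^ 2 / 6 * (‖v 0‖ + ‖v 1‖ + ‖v 2‖ + ‖v 3‖) ≤ t ^ 2 / 6 * (4 * t) := mul_le_mul_of_nonneg_left this (by positivity)
      _ = 2 / 3 * t ^ 3 := by ring
  have hb : ‖plaqLin v‖ ≤ 4 * t := by
    unfold plaqLin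
    calc ‖v 0 + v 1 - v 2 - v 3‖ ≤ ‖v 0‖ + ‖v 1‖ + ‖v 2‖ + ‖v 3‖ :=
          (norm_sub_le _ _).trans (add_le_add ((norm_sub_le _ _).trans (add_le_add (norm_add_le _ _) le_rfl)) le_rfl)
      _ ≤ 4 * t := by linarith [hv 0, hv 1, hv 2, hv 3]
  set S := Real.sinc ‖v 0‖ • v 0 + Real.sinc ‖v 1‖ • v 1 - Real.sinc ‖v 2‖ • v 2 - Real.sinc ‖v 3‖ • v 3 with hS
  have h1 : |‖S‖ - ‖plaqLin v‖| ≤ 2 / 3 * t ^ 3 := (abs_norm_sub_norm_le _ _).trans hd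
  have hS5 : ‖S‖ ≤ 5 * t := by
    have ht2 : t * t ≤ t := by nlinarith
    have ht3 : t ^ 3 ≤ t := by
      have h3 : t * t * t ≤ t * t * 1 := mul_le_mul_of_nonneg_left ht1 (mul_nonneg ht0 ht0)
      nlinarith
    linarith [(abs_le.1 h1).2]
  have h2 : |‖S‖ ^ 2 - ‖plaqLin v‖ ^ 2| = |‖S‖ - ‖plaqLin v‖| * (‖S‖ + ‖plaqLin v‖) := by
    rw [show ‖S‖ ^ 2 - ‖plaqLin v‖ ^ 2 = (‖S‖ - ‖plaqLin v‖) * (‖S‖ + ‖plaqLin v‖) by ring, abs_mul,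
      abs_of_nonneg (by positivity : 0 ≤ ‖S‖ + ‖plaqLin v‖)]
  rw [h2]
  calc |‖S‖ - ‖plaqLin v‖| * (‖S‖ + ‖plaqLin v‖) ≤ 2 / 3 * t ^ 3 * (5 * t + 4 * t) :=
        mul_le_mul h1 (add_le_add hS5 hb) (by positivity) (by positivity)
    _ = 6 * t ^ 4 := by ring

/-- **Clause 1 for four chart points**: `|cost(v) − ‖plaqLin v‖² − (cost(v) − cost(−v))/2| ≤ 42t⁴`. -/
theorem abs_even_remainder_le (v : Fin 4 → E3) {t : ℝ} (ht0 : 0 ≤ t) (ht1 : t ≤ 1) (hv : ∀ i, ‖v i‖ ≤ t) :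
    |(2 - (((expPauli (v 0) * expPauli (v 1) * (expPauli (v 2))⁻¹ * (expPauli (v 3))⁻¹ : SU2) : Matrix (Fin 2) (Fin 2) ℂ)).trace.re)
      - ‖plaqLin v‖ ^ 2
      - ((2 - (((expPauli (v 0) * expPauli (v 1) * (expPauli (v 2))⁻¹ * (expPauli (v 3))⁻¹ : SU2) : Matrix (Fin 2) (Fin 2) ℂ)).trace.re)
          - (2 - (((expPauli (-v 0) * expPauli (-v 1) * (expPauli (-v 2))⁻¹ * (expPauli (-v 3))⁻¹ : SU2) :
              Matrix (Fin 2) (Fin 2) ℂ)).trace.re)) / 2| ≤ 42 * t ^ 4 := by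
  rw [re_trace_eq, re_trace_neg_eq]
  have hE := even_decomp (Real.cos ‖v 0‖) (Real.cos ‖v 1‖) (Real.cos ‖v 2‖) (Real.cos ‖v 3‖)
    (Real.sinc ‖v 0‖ • WithLp.ofLp (v 0)) (Real.sinc ‖v 1‖ • WithLp.ofLp (v 1)) (Real.sinc ‖v 2‖ • WithLp.ofLp (v 2))
    (Real.sinc ‖v 3‖ • WithLp.ofLp (v 3))
  have hB := abs_even_le (Real.cos ‖v 0‖) (Real.cos ‖v 1‖) (Real.cos ‖v 2‖) (Real.cos ‖v 3‖)
    (Real.sinc ‖v 0‖ • WithLp.ofLp (v 0)) (Real.sinc ‖v 1‖ • WithLp.ofLp (v 1)) (Real.sinc ‖v 2‖ • WithLp.ofLp (v 2))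
    (Real.sinc ‖v 3‖ • WithLp.ofLp (v 3)) ht1 (hv 0) (hv 1) (hv 2) (hv 3) (norm_nonneg _) (norm_nonneg _) (norm_nonneg _) (norm_nonneg _)
    Real.one_sub_sq_div_two_le_cos Real.one_sub_sq_div_two_le_cos Real.one_sub_sq_div_two_le_cos Real.one_sub_sq_div_two_le_cos
    (Real.cos_le_one _) (Real.cos_le_one _) (Real.cos_le_one _) (Real.cos_le_one _)
    (PlaqCost.sinc_smul_dot_self (v 0)) (PlaqCost.sinc_smul_dot_self (v 1)) (PlaqCost.sinc_smul_dot_self (v 2))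
    (PlaqCost.sinc_smul_dot_self (v 3))
  rw [← hE] at hB
  have hss : (Real.sinc ‖v 0‖ • WithLp.ofLp (v 0) + Real.sinc ‖v 1‖ • WithLp.ofLp (v 1) - Real.sinc ‖v 2‖ • WithLp.ofLp (v 2) -
      Real.sinc ‖v 3‖ • WithLp.ofLp (v 3)) ⬝ᵥ (Real.sinc ‖v 0‖ • WithLp.ofLp (v 0) + Real.sinc ‖v 1‖ • WithLp.ofLp (v 1) -
      Real.sinc ‖v 2‖ • WithLp.ofLp (v 2) - Real.sinc ‖v 3‖ • WithLp.ofLp (v 3)) =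
      ‖Real.sinc ‖v 0‖ • v 0 + Real.sinc ‖v 1‖ • v 1 - Real.sinc ‖v 2‖ • v 2 - Real.sinc ‖v 3‖ • v 3‖ ^ 2 := by
    rw [ofLp_sincSum, SmallFieldPlaq.dotProduct_self_eq_norm_sq]
  rw [hss] at hB
  have hSb := abs_norm_sincSum_sq_sub_le v ht0 ht1 hv
  have hsq : ‖v 0‖ ^ 2 + ‖v 1‖ ^ 2 + ‖v 2‖ ^ 2 + ‖v 3‖ ^ 2 ≤ 4 * t ^ 2 := by
    have := fun i => pow_le_pow_left₀ (norm_nonneg (v i)) (hv i) 2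
    linarith [this 0, this 1, this 2, this 3]
  have h36 : 9 * t ^ 2 * (‖v 0‖ ^ 2 + ‖v 1‖ ^ 2 + ‖v 2‖ ^ 2 + ‖v 3‖ ^ 2) ≤ 36 * t ^ 4 := by
    calc 9 * t ^ 2 * (‖v 0‖ ^ 2 + ‖v 1‖ ^ 2 + ‖v 2‖ ^ 2 + ‖v 3‖ ^ 2) ≤ 9 * t ^ 2 * (4 * t ^ 2) :=
          mul_le_mul_of_nonneg_left hsq (by positivity)
      _ = 36 * t ^ 4 := by ring
  -- |X − ‖b‖² − odd| = |(X − odd − s·s) + (s·s − ‖b‖²)|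
  have key : ∀ (X Y sS bb : ℝ), |X - sS - (X - Y) / 2 - 0| ≤ 36 * t ^ 4 → |sS - bb| ≤ 6 * t ^ 4 →
      |X - bb - (X - Y) / 2| ≤ 42 * t ^ 4 := by
    intro X Y sS bb h1 h2
    rw [sub_zero] at h1
    calc |X - bb - (X - Y) / 2| = |(X - sS - (X - Y) / 2) + (sS - bb)| := by ring_nf
      _ ≤ |X - sS - (X - Y) / 2| + |sS - bb| := abs_add_le _ _
      _ ≤ 42 * t ^ 4 := by linarith
  refine key _ _ _ _ ?_ hSb
  rw [sub_zero]
  refine le_trans (le_of_eq ?_) (hB.trans h36)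
  congr 1
  ring

/-- **Clause 2 for four chart points**: the odd part against the triple-product form, `≤ 8t⁵`. -/
theorem abs_odd_remainder_le (v : Fin 4 → E3) {t : ℝ} (ht1 : t ≤ 1) (hv : ∀ i, ‖v i‖ ≤ t) :
    |((2 - (((expPauli (v 0) * expPauli (v 1) * (expPauli (v 2))⁻¹ * (expPauli (v 3))⁻¹ : SU2) : Matrix (Fin 2) (Fin 2) ℂ)).trace.re)
        - (2 - (((expPauli (-v 0) * expPauli (-v 1) * (expPauli (-v 2))⁻¹ * (expPauli (-v 3))⁻¹ : SU2) :
            Matrix (Fin 2) (Fin 2) ℂ)).trace.re)) / 2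
      - (-2 * (WithLp.ofLp (v 1) ⬝ᵥ (WithLp.ofLp (v 2) ⨯₃ WithLp.ofLp (v 3)))
          - 2 * (WithLp.ofLp (v 0) ⬝ᵥ (WithLp.ofLp (v 2) ⨯₃ WithLp.ofLp (v 3)))
          + 2 * (WithLp.ofLp (v 0) ⬝ᵥ (WithLp.ofLp (v 1) ⨯₃ WithLp.ofLp (v 3)))
          + 2 * (WithLp.ofLp (v 0) ⬝ᵥ (WithLp.ofLp (v 1) ⨯₃ WithLp.ofLp (v 2))))| ≤ 8 * t ^ 5 := by
  rw [re_trace_eq, re_trace_neg_eq]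
  have hs : ∀ i, 1 - ‖v i‖ ^ 2 / 6 ≤ Real.sinc ‖v i‖ := fun i => by
    linarith [(abs_le.1 (abs_sinc_sub_one_le (norm_nonneg (v i)))).1]
  have hn : ∀ i, Real.sqrt (WithLp.ofLp (v i) ⬝ᵥ WithLp.ofLp (v i)) ≤ ‖v i‖ := fun i => (WilsonSandwich.sqrt_dot_self (v i)).le
  have h := abs_odd_sub_triple_le (Real.cos ‖v 0‖) (Real.cos ‖v 1‖) (Real.cos ‖v 2‖) (Real.cos ‖v 3‖)
    (Real.sinc ‖v 0‖) (Real.sinc ‖v 1‖) (Real.sinc ‖v 2‖) (Real.sinc ‖v 3‖)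
    (WithLp.ofLp (v 0)) (WithLp.ofLp (v 1)) (WithLp.ofLp (v 2)) (WithLp.ofLp (v 3)) ht1 (hv 0) (hv 1) (hv 2) (hv 3)
    (norm_nonneg _) (norm_nonneg _) (norm_nonneg _) (norm_nonneg _)
    Real.one_sub_sq_div_two_le_cos Real.one_sub_sq_div_two_le_cos Real.one_sub_sq_div_two_le_cos Real.one_sub_sq_div_two_le_cos
    (Real.cos_le_one _) (Real.cos_le_one _) (Real.cos_le_one _) (Real.cos_le_one _) (hs 0) (hs 1) (hs 2) (hs 3)
    (Real.sinc_le_one _) (Real.sinc_le_one _) (Real.sinc_le_one _) (Real.sinc_le_one _) (hn 0) (hn 1) (hn 2) (hn 3)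
  refine le_trans (le_of_eq ?_) h
  congr 1
  ring

end WilsonTaylor

end Summit.QuantumFields.YangMills.Theorems.AllWindowsColdBoxBoxHighLine

end
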